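import Summits.PneNP.PneNP.Theses.LatticeMagic
import Summits.PneNP.PneNP.Theorems.LatticeMagicTargetIffNPneCoNP
import Literature.Algebra.EuclideanLattices.LatticeGapNPcoNPLemmaA1

/-!
# Route LatticeMagic, crux `Target` (stmt-PneNP-10709) — line `Sketch` (card `certified-deep-holes`):
# the two transfers of the line, and the strength of its apex

The line replaces the ∀t-shape of `Target` ("some NP language contains the code of EVERY `c·d`-far
instance `((B,t),d)` and of no `d`-close one") by

* **C⁺ = RemotePointUncertifiable** (lattice Remote-Point ∉ SearchNP; the line's single registered stub
  `stub_remotePointUncertifiable` of `Cruxes/Target/Lines/Sketch.lean`, conjecture-grade, stated here as the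
  ANTECEDENT of `latticeMagicTarget_of_remotePointUncertifiable`): for some constant `c ≥ 1`, every `NP` language
  that is sound for farness (contains the code of no instance with `dist(t, L(B)) ≤ d`) certifies NO integer
  point of some lattice-with-radius `(B, d)` that does possess a `c·d`-far integer point (Guruswami–Micciancio–Regev
  2005, §4 (GapCRP); the factor-√n certified deep hole of their §4.2 is the positive side of the same question);
* **S⁺** = "GapSVP_c ∉ PromiseCoNP for some constant `c ≥ 1`" (the homogeneous transfer).

Both imply `Target` (`latticeMagicTarget_of_remotePointUncertifiable`, five lines;
`latticeMagicTarget_of_gapSVP_not_mem_promiseCoNP`, by the tree's discharged Aharonov–Regev Lemma A.1) — these two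
are registered sub-goals of stmt-PneNP-10709 — hence each implies `NP ≠ coNP` by the tree theorem
`latticeMagicTarget_iff_NP_ne_coNP` (`Theorems/LatticeMagicTargetIffNPneCoNP.lean`): the apex of the line is at
least as strong as `NP ≠ coNP` (`NP_ne_coNP_of_remotePointUncertifiable`, `NP_ne_coNP_of_gapSVP_not_mem_promiseCoNP`),
the kernel-checked content of the line's verdict.
-/

set_option linter.dupNamespace false

noncomputable section

namespace Summit.PneNP.PneNP.Theorems

open Literature.Algebra.EuclideanLattices Literature.Computability.Complexity
open Summit.PneNP.PneNP.Theses.LatticeMagic (Target)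

/-- **C⁺ → Target** (line `Sketch`, transfer; registered sub-goal). If a `coNP` language `K` separated GapCVP_c,
then `X := Kᶜ ∈ NP` is sound for farness (contains no YES code) and contains every NO code; C⁺ yields a lattice
`(I, d)` with a `c·d`-far integer point `t` — a NO instance, whose code lies in `X` — and yet no code `((I, t), d)`
in `X`. CONDITIONAL on C⁺ (open, ≥ `NP ≠ coNP`); unconditional otherwise. (C⁺ is the constant-factor case of the
certified-remote-point question whose factor-√n case is solved by "guess a deep hole, then run Aharonov–Regev",
Guruswami–Micciancio–Regev 2005 §4.2.) [folklore] -/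
theorem latticeMagicTarget_of_remotePointUncertifiable :
    (∃ c : ℝ, 1 ≤ c ∧ ∀ X : Language Bool, X ∈ Literature.Computability.Complexity.Nondeterministic.NP → (∀ p : Literature.Algebra.EuclideanLattices.GapCVPInstance, p ∈ Literature.Algebra.EuclideanLattices.GapCVP.yes (fun _ => c) → Literature.Algebra.EuclideanLattices.GapCVPInstance.encode p ∉ X) → ∃ (I : Literature.Algebra.EuclideanLattices.LatticeInstance) (d : ℚ), (∃ t : Fin I.n → ℤ, (((⟨I, t⟩ : Literature.Algebra.EuclideanLattices.CVPInstance), d) : Literature.Algebra.EuclideanLattices.GapCVPInstance) ∈ Literature.Algebra.EuclideanLattices.GapCVP.no (fun _ => c)) ∧ ∀ t : Fin I.n → ℤ, Literature.Algebra.EuclideanLattices.GapCVPInstance.encode (((⟨I, t⟩ : Literature.Algebra.EuclideanLattices.CVPInstance), d) : Literature.Algebra.EuclideanLattices.GapCVPInstance) ∉ X) → Summit.PneNP.PneNP.Theses.LatticeMagic.Target := by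
  rintro ⟨c, hc, hC⟩
  refine ⟨c, hc, ?_⟩
  rintro ⟨K, hK, hyes, hno⟩
  have hX : Kᶜ ∈ Nondeterministic.NP := hK
  have hsound : ∀ p : GapCVPInstance, p ∈ GapCVP.yes (fun _ => c) → GapCVPInstance.encode p ∉ Kᶜ :=
    fun p hp hpX => hpX (hyes ⟨p, hp, rfl⟩)
  obtain ⟨I, d, ⟨t, ht⟩, hnone⟩ := hC Kᶜ hX hsound
  exact hnone t (hno ⟨_, ht, rfl⟩)

/-- **S⁺ → Target** (registered sub-goal): `GapSVP_c ∉ PromiseCoNP` for a constant `c ≥ 1` gives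
`GapCVP_c ∉ PromiseCoNP` for the same `c`, by the tree's discharged Aharonov–Regev Lemma A.1
(`AharonovRegev2005_lemmaA1_holds`: GapCVP_γ ∈ PromiseCoNP ⇒ GapSVP_γ ∈ PromiseCoNP, the GMSS coset reduction).
[cite: AharonovRegev2005, Lemma A.1 (App. A, p. 14)] -/
theorem latticeMagicTarget_of_gapSVP_not_mem_promiseCoNP :
    (∃ c : ℝ, 1 ≤ c ∧ Literature.Algebra.EuclideanLattices.gapSVPPromise (fun _ => c) ∉ Literature.Computability.Complexity.PromiseCoNP) → Summit.PneNP.PneNP.Theses.LatticeMagic.Target := by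
  rintro ⟨c, hc, hS⟩
  exact ⟨c, hc, fun hco => hS (AharonovRegev2005_lemmaA1_holds (fun _ => c) hco)⟩

/-- **Strength of the apex: C⁺ → NP ≠ coNP** (through `Target ↔ NP ≠ coNP`). So the line's single stub cannot
be landed short of a tree proof of `NP ≠ coNP`. [folklore] -/
theorem NP_ne_coNP_of_remotePointUncertifiable
    (hC : ∃ c : ℝ, 1 ≤ c ∧ ∀ X : Language Bool, X ∈ Nondeterministic.NP →
      (∀ p : GapCVPInstance, p ∈ GapCVP.yes (fun _ => c) → GapCVPInstance.encode p ∉ X) →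
      ∃ (I : LatticeInstance) (d : ℚ),
        (∃ t : Fin I.n → ℤ, (((⟨I, t⟩ : CVPInstance), d) : GapCVPInstance) ∈ GapCVP.no (fun _ => c)) ∧
        ∀ t : Fin I.n → ℤ, GapCVPInstance.encode (((⟨I, t⟩ : CVPInstance), d) : GapCVPInstance) ∉ X) :
    Nondeterministic.NP ≠ coNP :=
  NP_ne_coNP_of_latticeMagicTarget (latticeMagicTarget_of_remotePointUncertifiable hC)

/-- **S⁺ → NP ≠ coNP** likewise. [folklore] -/
theorem NP_ne_coNP_of_gapSVP_not_mem_promiseCoNP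
    (hS : ∃ c : ℝ, 1 ≤ c ∧ gapSVPPromise (fun _ => c) ∉ PromiseCoNP) : Nondeterministic.NP ≠ coNP :=
  NP_ne_coNP_of_latticeMagicTarget (latticeMagicTarget_of_gapSVP_not_mem_promiseCoNP hS)

end Summit.PneNP.PneNP.Theorems
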